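import Summits.BirchSwinnertonDyer.Rank1Residual.O5.FlexTangentNormalFormThree
import Summits.BirchSwinnertonDyer.Rank1Residual.O5.SupersingularLocalClassUniqueThreeTame
import Summits.BirchSwinnertonDyer.Rank1Residual.O5.O5RationalTorsionCostLaw
import HarnessLib

/-!
# O5 — T29.6 AT CURVE LEVEL `FlatKummerImageTypeIIIThree` PROVED AS TYPED (`_holds`): a type-`III` curve at `3`
# with a `ℚ₃`-rational `3`-torsion point has `φ̂`-Kummer image the FLAT line `U`
# (cell `b2b-bsdres`, team n1011, ROW T-FLEX-KOD extension 2, FILE B — END; seat `b2b-bsdres-n1011-p18` GEN 14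
#  under the idle rule; the object of x11b3's former "T29.6 assembly FILE B" (x11b3-lead GEN 16, HOME l.8043))

HONEST FRAMING (cell `b2b-bsdres`, run/shared/lean/b2b/bsd-rank1-residual/, verbatim in every file): the
goal of the cell is to DELETE the COMBINATION-SHAPED residual classes of the Birch–Swinnerton-Dyer formula
for ALL analytic-rank `≤ 1` elliptic curves over `ℚ` — "full BSD formula for every rank `≤ 1` curve in
class `C`" assembled STRICTLY from published theorems — so that the rank-`≤ 1` remainder becomes exactly
the CONSTRUCTION-SHAPED classes, which are TYPED (missing-input `Prop`s), NOT attempted. This is not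
"finishing BSD". Lane CLASS-CLOSURE / O5 (O5 OPEN): research route; census output (P-K18 / P-K19) is
EVIDENCE, never a Literature fact; nothing is booked; no mark of `RESIDUAL-MAP.md` moves. This file:
THEOREMS ONLY (no definition, no named fact, no `@[conjecture]` node, no `sorry`; net named-fact debt `0`);
nothing of cc-typer-5's / o5-r1's files is edited (the `@[conjecture]` tag's retirement is the typer's
docket); a `_holds` theorem for a conjecture node closes NO pair and moves NO mark.

## What is proved

* `kummerImage_flat_and_hasUnit_of_kodairaSymbolAt_III`: for `W/ℚ` elliptic with Kodaira type `III` at `3`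
  and `v₃(Δ(W)) = 3`, and a `ℚ₃`-point `P₀ = (x₀, y₀)` with `Ψ₃(x₀) = 0`
  (`IsRationalThreeTorsionPointAtThree`): `KummerImageFlatAtThree W x₀ y₀ ∧ KummerImageHasUnitAtThree W x₀ y₀`
  — every tangent-line value `y − y₀ − m₀(x − x₀)` at a `ℚ₃`-point with `x ≠ x₀` is `≠ 0` with `3 ∣ v₃`, and
  one of them is a flat NON-cube.
* `flatKummerImageTypeIIIThree_holds : FlatKummerImageTypeIIIThree` — o5-r1 GEN 12's T29.6 + (b1) node
  (`O5/O5RationalTorsionCostLaw.lean`, cc-typer-5 A-O5-27; census P-K18 2 251/2 251) EXACTLY AS TYPED: on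
  `ClassO5 ∧ SubTprime` the Kodaira type is `III` or `III*` (`subTprime_three_iff_kodairaSymbolAt_III_or_IIIstar`)
  and `v₃Δ = 3` on the globally minimal `W` excludes `III*` (`ord₃Δ_min = m + 1 = 9`).

## Proof (no Tate run on the curve; `c₄, c₆, Δ` only)

FILE A's tangent change `(1, x₀, m₀, y₀)` turns `W ⊗ ℚ₃` into the flex form `F : y² + a·xy + d·y = x³`
(`d = 2y₀ + a₁x₀ + a₃ ≠ 0`) with the SAME `c₄, c₆, Δ`, and the tangent value of `(x, y)` is the new
`y`-coordinate.  Tate's `III` form `J` of `W ⊗ ℚ₃` over `ℤ₃` (n1011-p05's `exists_IIIForm`, from the tree's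
`exists_smul_of_kodairaSymbolOfMinimal_eq_III` + `kodairaSymbolAt_eq_padic`) is reached by SOME `ℚ₃`-change
`C`; only `u = C.u` matters: `‖Δ_J‖ = 3⁻³ = ‖Δ(W)‖` forces `‖u‖ = 1`, then `‖c₄(W)‖ = ‖c₄(J)‖ ≤ 3⁻² < 1`, so
x11b3-p7's END-1 (`norm_a₃_eq_one_and_norm_a₁_lt_one`) gives `‖d‖ = 1`, `3 ∣ a`, END-2
(`ne_zero_and_three_dvd_valuation`) the FLAT half, and the unit class comes from END-3 (`exists_point_not_cube`)
once `d` is not a cube: `c₆ = 27(−27b⁶ + 36b³d − 8d²) = u⁶ · c₆(J) = u⁶ · 27 · (−64α₂³ + 24α₂α₄ + 9q)` read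
modulo `9` (`u⁶ ≡ 1`, `−8 ≡ 1`) is `d̄² = −64ᾱ₂³ + 24ᾱ₂ᾱ₄`, never `1` for a unit `ᾱ₄` (`decide` over `ℤ/9`),
so `d ≢ ±1 (mod 9)` and `not_exists_pow_three_eq_of_sq_ne_one` applies.

References: Silverman *ATAEC* IV.9.4 Step 4, Table 4.1 [SilvermanATAEC1994]; T. and V. Dokchitser,
arXiv:1208.5519 Lemma 10 [DokchitserDokchitser2015LocalInvariantsIsogenous]; o5-r1 GEN 12
`T29-RATIONAL-TORSION-COST-LAW.md` §3 (law T29.6, P-K18 kit j141165: 2 251/2 251 class-01 type-III curves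
have `(k, t) = (1, U)`).
-/

noncomputable section

open Polynomial WeierstrassCurve

namespace Summit.BirchSwinnertonDyer.Rank1Residual.O5.FlexTangent

/-! ## §4 Assembly: Kodaira `III` at `3` and a `ℚ₃`-rational `3`-torsion point ⟹ flat Kummer image with a unit class -/

section Assembly

open Summit.BirchSwinnertonDyer.Rank1Residual.Additive (placeOf)
open Literature.NumberTheory.DiophantineGeometry

/-- **T29.6 at the level of the curve.**  Let `W/ℚ` be elliptic with Kodaira type `III` at `3` and
`v₃(Δ(W)) = 3` (e.g. `W` minimal at `3`), and let `P₀ = (x₀, y₀)` be a `ℚ₃`-rational point of order `3`.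
Then EVERY tangent-line value `y − y₀ − m₀(x − x₀)` at a `ℚ₃`-point with `x ≠ x₀` is flat (`≠ 0`,
`3 ∣ v₃`), and SOME such value is a flat NON-cube: the `φ̂`-Kummer image is the flat line `U`.
Proof: the tangent change `(1, x₀, m₀, y₀)` gives the flex form `y² + a·xy + d·y = x³` (§1) with the
same `c₄, c₆, Δ`; Tate's `III` form `J` of `W ⊗ ℚ₃` (`exists_IIIForm`) has `‖Δ_J‖ = 3⁻³`, `9 ∣ c₄(J)`, so the
comparison unit `u` has `‖u‖ = 1` and `‖c₄‖ < 1`; END-1 gives `‖d‖ = 1`, `3 ∣ a`; END-2 gives flatness;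
`c₆ = 27(−27b⁶ + 36b³d − 8d²) = u⁶ · 27 · z_J` read modulo `9` gives `d̄² = −64ᾱ₂³ + 24ᾱ₂ᾱ₄ ≠ 1`, so `d` is
not a cube (`not_exists_pow_three_eq_of_sq_ne_one`) and END-3 (`exists_point_not_cube`) supplies the unit class.
[cite: SilvermanATAEC1994, IV.9.4 Step 4 (Tate's algorithm, type III)]
[cite: DokchitserDokchitser2015LocalInvariantsIsogenous, Lemma 10 (arXiv:1208.5519 p. 7)] -/
theorem kummerImage_flat_and_hasUnit_of_kodairaSymbolAt_III (W : WeierstrassCurve ℚ) [W.IsElliptic]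
    [Fact (Nat.Prime 3)] (hK : W.kodairaSymbolAt (placeOf 3) = .III) (hΔ : padicValRat 3 W.Δ = 3)
    {x₀ y₀ : ℚ_[3]} (hP : IsRationalThreeTorsionPointAtThree W x₀ y₀) :
    KummerImageFlatAtThree W x₀ y₀ ∧ KummerImageHasUnitAtThree W x₀ y₀ := by
  -- the curve over `ℚ₃`
  set E := W.baseChange ℚ_[3] with hE
  have hEΔ : E.Δ = (W.Δ : ℚ_[3]) := by
    rw [hE, WeierstrassCurve.baseChange, WeierstrassCurve.map_Δ, eq_ratCast]
  have hWΔ : W.Δ ≠ 0 := W.isUnit_Δ.ne_zero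
  have hEΔ0 : E.Δ ≠ 0 := by rw [hEΔ]; exact_mod_cast hWΔ
  have hvΔ : E.Δ.valuation = 3 := by rw [hEΔ, Padic.valuation_ratCast, hΔ]
  have hnΔ : ‖E.Δ‖ = (3 : ℝ)⁻¹ ^ 3 := by
    rw [Padic.norm_eq_zpow_neg_valuation hEΔ0, hvΔ]; norm_num
  -- the tangent change to the flex form `F = y² + a·xy + d·y − x³`
  set d := 2 * y₀ + E.a₁ * x₀ + E.a₃ with hd
  set m := (3 * x₀ ^ 2 + 2 * E.a₂ * x₀ + E.a₄ - E.a₁ * y₀) / (2 * y₀ + E.a₁ * x₀ + E.a₃) with hm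
  have hd0 : d ≠ 0 := tangentDen_ne_zero E x₀ y₀ hEΔ0 hP.1 hP.2
  set F := ((⟨1, x₀, m, y₀⟩ : VariableChange ℚ_[3]) • E) with hF
  obtain ⟨h2, h3, h4, h6⟩ := smul_tangent_eqs E x₀ y₀ m hP.1 hP.2 hd0 hm
  set a := F.a₁ with ha
  obtain ⟨hc₄F, hc₆F, hΔF⟩ := c₄_c₆_Δ_of_flex h2 h4 h6
  obtain ⟨hc₄E, hc₆E, hΔE⟩ := smul_c₄_c₆_Δ E x₀ y₀ m
  rw [← hF] at hc₄E hc₆E hΔE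
  rw [h3] at hc₄F hc₆F hΔF
  -- Tate's `III` form of `E`
  obtain ⟨C, J, α₁, α₂, α₃, α₄, α₆, hCJ, hα₁, hα₂, hα₃, hα₄, hα₄u, hα₆⟩ := exists_IIIForm W hK
  have hJΔ : (C • E).Δ = (J.Δ : ℚ_[3]) := by
    rw [hCJ, WeierstrassCurve.map_Δ, PadicInt.algebraMap_apply]
  have hJc₄ : (C • E).c₄ = (J.c₄ : ℚ_[3]) := by
    rw [hCJ, WeierstrassCurve.map_c₄, PadicInt.algebraMap_apply]
  have hJc₆ : (C • E).c₆ = (J.c₆ : ℚ_[3]) := by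
    rw [hCJ, WeierstrassCurve.map_c₆, PadicInt.algebraMap_apply]
  rw [variableChange_Δ] at hJΔ
  rw [variableChange_c₄] at hJc₄
  rw [variableChange_c₆] at hJc₆
  set u : ℚ_[3] := ((C.u⁻¹ : ℚ_[3]ˣ) : ℚ_[3]) with hu
  -- `‖u‖ = 1`
  have hnJΔ : ‖(J.Δ : ℚ_[3])‖ = (3 : ℝ)⁻¹ ^ 3 := by
    rw [← PadicInt.norm_def]; exact IIIForm.norm_Δ J hα₁ hα₂ hα₃ hα₄ hα₆ hα₄u
  have hu1 : ‖u‖ = 1 := by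
    have h := congrArg (‖·‖) hJΔ
    simp only [norm_mul, norm_pow, hnΔ, hnJΔ] at h
    have h' : ‖u‖ ^ 12 = 1 := by
      have h3 : ((3 : ℝ)⁻¹ ^ 3) ≠ 0 := by positivity
      exact mul_right_cancel₀ h3 (by rw [one_mul]; exact h)
    exact (pow_eq_one_iff_of_nonneg (norm_nonneg _) (by norm_num)).1 h'
  -- `‖c₄‖ < 1`, then END-1: `‖d‖ = 1`, `‖a‖ < 1`
  have hc₄ : ‖a * (a ^ 3 - 24 * d)‖ < 1 := by
    rw [← hc₄F, hc₄E]
    have h : ‖u ^ 4 * E.c₄‖ = ‖(J.c₄ : ℚ_[3])‖ := by rw [hJc₄]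
    rw [norm_mul, norm_pow, hu1, one_pow, one_mul] at h
    rw [h, ← PadicInt.norm_def]
    exact (IIIForm.norm_c₄_le J hα₁ hα₂ hα₃ hα₄).trans_lt (by norm_num)
  have hval : (d ^ 3 * (a ^ 3 - 27 * d)).valuation = 3 := by rw [← hΔF, hΔE, hvΔ]
  obtain ⟨hd1, ha1⟩ := ThreeTorsionNormalForm.norm_a₃_eq_one_and_norm_a₁_lt_one hd0 hval hc₄
  -- the equation of `F` at a transported point
  have hFeq : ∀ X Y : ℚ_[3], F.toAffine.Equation X Y ↔ Y ^ 2 + a * X * Y + d * Y = X ^ 3 := by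
    intro X Y
    rw [Affine.equation_iff, h2, h3, h4, h6]
    constructor <;> intro h <;> linear_combination h
  have htv : ∀ x y : ℚ_[3], tangentValueAtThree W x₀ y₀ x y = y - y₀ - m * (x - x₀) := by
    intro x y; rfl
  refine ⟨?_, ?_⟩
  · -- FLAT half (END-2)
    intro x y hxy hx
    have hF' := (equation_smul_iff E x₀ y₀ m x y).2 hxy
    rw [hFeq] at hF'
    rw [IsFlatClassAtThree, htv]
    exact ThreeTorsionNormalForm.ne_zero_and_three_dvd_valuation hd1 ha1.le hF' (sub_ne_zero.2 hx)
  · -- UNIT half: `d` is not a cube (the `c₆` residue), then END-3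
    -- integers `D = d`, `B = a/3`, `U = u`
    obtain ⟨D, hDd⟩ : ∃ D : ℤ_[3], (D : ℚ_[3]) = d := ⟨⟨d, hd1.le⟩, rfl⟩
    obtain ⟨B, hBa⟩ : ∃ B : ℤ_[3], (B : ℚ_[3]) = a / 3 := ⟨⟨a / 3, norm_div_three_le_one ha1⟩, rfl⟩
    obtain ⟨U, hUu⟩ : ∃ U : ℤ_[3], (U : ℚ_[3]) = u := ⟨⟨u, hu1.le⟩, rfl⟩
    have hD1 : ‖D‖ = 1 := by rw [PadicInt.norm_def, hDd]; exact hd1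
    have hU1 : ‖U‖ = 1 := by rw [PadicInt.norm_def, hUu]; exact hu1
    have ha3 : a = 3 * (B : ℚ_[3]) := by rw [hBa]; field_simp
    have hc₆F' : F.c₆ = -(a ^ 6 - 36 * a ^ 3 * d + 216 * d ^ 2) := hc₆F
    -- the `c₆` identity, in `ℚ₃` then in `ℤ₃`
    have hzJ := IIIForm.c₆_eq J hα₁ hα₂ hα₃ hα₄ hα₆
    have hQ : ((J.c₆ : ℤ_[3]) : ℚ_[3]) =
        (U : ℚ_[3]) ^ 6 * (27 * (-(27 * (B : ℚ_[3]) ^ 6) + 36 * (B : ℚ_[3]) ^ 3 * (D : ℚ_[3])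
          - 8 * (D : ℚ_[3]) ^ 2)) := by
      rw [← hJc₆, ← hc₆E, hc₆F', hUu, hDd, ha3]; ring
    have hZ : J.c₆ = U ^ 6 * (27 * (-(27 * B ^ 6) + 36 * B ^ 3 * D - 8 * D ^ 2)) := by
      apply Subtype.ext
      rw [hQ]
      norm_cast
    rw [hzJ] at hZ
    have hzU : -(64 * α₂ ^ 3) + 24 * α₂ * α₄ + 9 * (-(3 * α₁ ^ 6 + 12 * α₁ ^ 4 * α₂ + 16 * α₁ ^ 2 * α₂ ^ 2) +
        (8 * α₁ ^ 2 * α₄ + 12 * α₁ ^ 3 * α₃ + 8 * α₂ * α₄ + 16 * α₁ * α₂ * α₃) - 8 * (α₃ ^ 2 + 4 * α₆)) =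
        U ^ 6 * (-(27 * B ^ 6) + 36 * B ^ 3 * D - 8 * D ^ 2) := by
      have h27 : (27 : ℤ_[3]) ≠ 0 := by norm_num
      apply mul_left_cancel₀ h27
      rw [hZ]; ring
    -- read modulo `9`
    obtain ⟨u', hu'⟩ := exists_toZModPow_mul_eq_one hU1
    obtain ⟨α₄', hα₄'⟩ := exists_toZModPow_mul_eq_one (PadicInt.isUnit_iff.mp hα₄u)
    have h9 := congrArg (PadicInt.toZModPow 2) hzU
    simp only [map_add, map_sub, map_neg, map_mul, map_pow, map_ofNat] at h9
    have hU6 := zmod9_pow_six_eq_one _ _ hu'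
    have hres : (PadicInt.toZModPow 2 D) ^ 2 ≠ 1 := by
      have c9 : (9 : ZMod (3 ^ 2)) = 0 := by decide
      have c27 : (27 : ZMod (3 ^ 2)) = 0 := by decide
      have c36 : (36 : ZMod (3 ^ 2)) = 0 := by decide
      have key : (PadicInt.toZModPow 2 D) ^ 2 =
          -(64 * (PadicInt.toZModPow 2 α₂) ^ 3) +
            24 * (PadicInt.toZModPow 2 α₂) * (PadicInt.toZModPow 2 α₄) := by
        linear_combination (-1 : ZMod (3 ^ 2)) * h9
          - (-(27 * (PadicInt.toZModPow 2 B) ^ 6)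
              + 36 * (PadicInt.toZModPow 2 B) ^ 3 * (PadicInt.toZModPow 2 D)
              - 8 * (PadicInt.toZModPow 2 D) ^ 2) * hU6
          + ((PadicInt.toZModPow 2 D) ^ 2
              + (-(3 * (PadicInt.toZModPow 2 α₁) ^ 6 + 12 * (PadicInt.toZModPow 2 α₁) ^ 4 * (PadicInt.toZModPow 2 α₂)
                  + 16 * (PadicInt.toZModPow 2 α₁) ^ 2 * (PadicInt.toZModPow 2 α₂) ^ 2)
                + (8 * (PadicInt.toZModPow 2 α₁) ^ 2 * (PadicInt.toZModPow 2 α₄)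
                  + 12 * (PadicInt.toZModPow 2 α₁) ^ 3 * (PadicInt.toZModPow 2 α₃)
                  + 8 * (PadicInt.toZModPow 2 α₂) * (PadicInt.toZModPow 2 α₄)
                  + 16 * (PadicInt.toZModPow 2 α₁) * (PadicInt.toZModPow 2 α₂) * (PadicInt.toZModPow 2 α₃))
                - 8 * ((PadicInt.toZModPow 2 α₃) ^ 2 + 4 * (PadicInt.toZModPow 2 α₆)))) * c9
          + (PadicInt.toZModPow 2 B) ^ 6 * c27
          - (PadicInt.toZModPow 2 B) ^ 3 * (PadicInt.toZModPow 2 D) * c36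
      rw [key]
      exact zmod9_tate_residue_ne_one _ _ _ hα₄'
    have hnc : ¬ ∃ w : ℚ_[3], d = w ^ 3 := by
      rw [← hDd]; exact ThreeTorsionNormalForm.not_exists_pow_three_eq_of_sq_ne_one hD1 hres
    obtain ⟨X, Y, hXY, hX, hY⟩ := ThreeTorsionNormalForm.exists_point_not_cube hd1 ha1 hnc
    refine ⟨X + x₀, Y + y₀ + m * X, ?_, ?_, ?_, ?_⟩
    · rw [← equation_smul_iff E x₀ y₀ m, hFeq]
      convert hXY using 1 <;> ring
    · intro h; exact hX (by linear_combination h)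
    · rw [IsFlatClassAtThree, htv]
      have e2 : Y + y₀ + m * X - y₀ - m * (X + x₀ - x₀) = Y := by ring
      rw [e2]
      exact ThreeTorsionNormalForm.ne_zero_and_three_dvd_valuation hd1 ha1.le hXY hX
    · rw [IsCubeAtThree, htv]
      have e2 : Y + y₀ + m * X - y₀ - m * (X + x₀ - x₀) = Y := by ring
      rw [e2]; exact hY

/-- **T29.6 + (b1) `FlatKummerImageTypeIIIThree` PROVED AS TYPED (o5-r1 GEN 12 / cc-typer-5 A-O5-27,
`O5/O5RationalTorsionCostLaw.lean`).**  On O5(t′) (`ClassO5 ∧ SubTprime` = Kodaira `III` or `III*` at `3`,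
`subTprime_three_iff_kodairaSymbolAt_III_or_IIIstar`) the hypothesis `v₃Δ = 3` on the globally minimal `W` excludes
`III*` (`ord₃Δ_min = m + 1 = 9`, `ordMinimalDiscriminant_eq_numComponentsAt_add_one_of_kodairaSymbolAt`), and type
`III` is `kummerImage_flat_and_hasUnit_of_kodairaSymbolAt_III`; the hypothesis `numStableLinesAtThree W = 1` is not
needed (the torsion point is given).  Closes NO pair and moves NO mark; O5 OPEN.
[cite: SilvermanATAEC1994, IV.9.4 Step 4 and Table 4.1]
[cite: DokchitserDokchitser2015LocalInvariantsIsogenous, Lemma 10 (arXiv:1208.5519 p. 7)] -/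
theorem flatKummerImageTypeIIIThree_holds : FlatKummerImageTypeIIIThree := by
  intro W _ _ h5 ht hΔ _ x₀ y₀ hP
  haveI : Fact (Nat.Prime 3) := ⟨Nat.prime_three⟩
  rcases (Additive.subTprime_three_iff_kodairaSymbolAt_III_or_IIIstar W h5.2.1).mp ht with hIII | hIIIstar
  · exact kummerImage_flat_and_hasUnit_of_kodairaSymbolAt_III W hIII hΔ hP
  · -- `III*` is impossible: `ord₃ Δ_min = 9 ≠ 3 = v₃ Δ(W)` on the globally minimal `W`
    exfalso
    haveI : PerfectField (IsLocalRing.ResidueField ((placeOf 3).adicCompletionIntegers ℚ)) :=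
      PerfectField.ofFinite
    have h2 : ringChar (ℤ ⧸ (placeOf 3).asIdeal) ≠ 2 := by
      rw [Additive.ringChar_int_quot_placeOf 3]; decide
    have hord := W.ordMinimalDiscriminant_eq_numComponentsAt_add_one_of_kodairaSymbolAt (placeOf 3) h2
      (Or.inr (Or.inl hIIIstar))
    rw [Additive.ordMinimalDiscriminant_placeOf_eq W 3] at hord
    unfold WeierstrassCurve.numComponentsAt at hord
    rw [hIIIstar] at hord
    simp only [KodairaSymbol.numComponents] at hord
    have hv : padicValRat 3 W.Δ = padicValInt 3 W.minimalDiscriminantInt := by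
      rw [← cast_minimalDiscriminantInt W, padicValRat.of_int]
    rw [hv, hord] at hΔ
    norm_num at hΔ

end Assembly

end Summit.BirchSwinnertonDyer.Rank1Residual.O5.FlexTangent
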